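import Mathlib.GroupTheory.FreeAbelianGroup
import Mathlib.GroupTheory.Congruence.Defs
import Mathlib.Algebra.Group.Subgroup.Lattice
import Mathlib.Algebra.Order.Group.Multiset
import Mathlib.Algebra.BigOperators.Group.Multiset.Basic
import Mathlib.Tactic.Abel

/-!
# `ℤ`-span versus honest chains of moves: the Grothendieck-group lemma (THEOREM CH, part 1)

The summit `KontsevichZagierPeriods` reads Kontsevich–Zagier's "one can pass from one formula to
another using only rules 1), 2), 3)" as *`ℤ`-span membership*: `[r] − [r'] ∈ KZ.relations`, the
subgroup of the free abelian group on integral representations generated by the move instances.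
An *honest chain* instead acts on finite families (multisets) of integral representations and, at
each step, replaces one side of a move instance, present in the current family, by its other side.

This file proves the purely algebraic comparison of the two readings, for an ARBITRARY calculus:
a type `X` of generators and a set `E` of *rewrite pairs* `(a, b)` of finite families
(`Multiset X`).  Writing `Σ a` for the formal sum of a family in `FreeAbelianGroup X`,

* `soloInformedPairSpan E` is the `ℤ`-span of the differences `Σ a − Σ b`, `(a, b) ∈ E`;
* `SoloInformedMoveChain E` is the honest-chain relation: the additive congruence on `Multiset X`
  generated by `E` (Mathlib's inductive `AddConGen.Rel`: one may rewrite `a ↦ b` or `b ↦ a`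
  inside any larger family, finitely often);

and **THEOREM CH-1** (`soloInformed_msum_sub_msum_mem_pairSpan_iff`):

  `Σ x − Σ y ∈ soloInformedPairSpan E ↔ ∃ t, SoloInformedMoveChain E (x + t) (y + t)`,

i.e. `ℤ`-span membership is honest chain-connectedness *after adjoining a common auxiliary family*
`t` (a "catalyst").  This is the description of equality in the Grothendieck group of the
commutative monoid `Multiset X ⧸ SoloInformedMoveChain E`; the proof is a direct induction over the
span, using that `Multiset X → FreeAbelianGroup X` is injective.  Part 2
(`SoloInformedKZChain`) instantiates it to the four KZ moves and to the scissors group `𝒮`, and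
removes the catalyst for the KZ calculus.
-/

namespace Summit.KontsevichZagierPeriods.KontsevichZagierPeriods.Theorems

variable {X : Type*}

/-! ### Formal sums of finite families -/

/-- The formal sum `Σ s` of a finite family (multiset) of generators, in the free abelian group.
[folklore] -/
def soloInformedMsum : Multiset X →+ FreeAbelianGroup X where
  toFun s := (s.map FreeAbelianGroup.of).sum
  map_zero' := by simp
  map_add' s t := by simp [Multiset.map_add, Multiset.sum_add]

/-- `Σ {x} = [x]`. [folklore] -/
@[simp] theorem soloInformedMsum_singleton (x : X) :
    soloInformedMsum ({x} : Multiset X) = FreeAbelianGroup.of x := by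
  simp [soloInformedMsum]

/-- `Σ (x ::ₘ s) = [x] + Σ s`. [folklore] -/
@[simp] theorem soloInformedMsum_cons (x : X) (s : Multiset X) :
    soloInformedMsum (x ::ₘ s) = FreeAbelianGroup.of x + soloInformedMsum s := by
  simp [soloInformedMsum]

/-- `Σ {x, y} = [x] + [y]`. [folklore] -/
theorem soloInformedMsum_pair (x y : X) :
    soloInformedMsum ({x, y} : Multiset X) = FreeAbelianGroup.of x + FreeAbelianGroup.of y := by
  rw [Multiset.insert_eq_cons, soloInformedMsum_cons, soloInformedMsum_singleton]

/-- The coefficient of a generator, an additive functional on the free abelian group.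
[folklore] -/
def soloInformedCoeff [DecidableEq X] (a : X) : FreeAbelianGroup X →+ ℤ :=
  FreeAbelianGroup.lift fun b => if b = a then 1 else 0

/-- The coefficient of `a` in `Σ s` is the multiplicity of `a` in `s`. [folklore] -/
theorem soloInformedCoeff_msum [DecidableEq X] (a : X) (s : Multiset X) :
    soloInformedCoeff a (soloInformedMsum s) = (s.count a : ℤ) := by
  induction s using Multiset.induction_on with
  | empty => simp
  | cons b s ih =>
    rw [soloInformedMsum_cons, map_add, ih, Multiset.count_cons, add_comm]
    unfold soloInformedCoeff
    rw [FreeAbelianGroup.lift_apply_of]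
    by_cases h : a = b
    · subst h; simp
    · simp [h, Ne.symm h]

/-- **Finite families embed in the free abelian group**: `Σ` is injective. [folklore] -/
theorem soloInformedMsum_injective :
    Function.Injective (soloInformedMsum : Multiset X → FreeAbelianGroup X) := by
  classical
  intro s t h
  ext a
  have h' := congrArg (soloInformedCoeff a) h
  rw [soloInformedCoeff_msum, soloInformedCoeff_msum] at h'
  exact_mod_cast h'

/-- Every element of the free abelian group is a difference `Σ a − Σ b` of two finite families.
[folklore] -/
theorem soloInformed_exists_eq_msum_sub_msum (z : FreeAbelianGroup X) :
    ∃ a b : Multiset X, z = soloInformedMsum a - soloInformedMsum b := by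
  induction z using FreeAbelianGroup.induction_on with
  | zero => exact ⟨0, 0, by simp⟩
  | of x => exact ⟨{x}, 0, by simp⟩
  | neg x _ => exact ⟨0, {x}, by simp⟩
  | add x y hx hy =>
    obtain ⟨a, b, rfl⟩ := hx
    obtain ⟨c, d, rfl⟩ := hy
    exact ⟨a + c, b + d, by rw [map_add, map_add]; abel⟩

/-! ### Span and chains of a set of rewrite pairs -/

/-- **The `ℤ`-span of a calculus.** For a set `E` of rewrite pairs `(a, b)` of finite families, the
subgroup of `FreeAbelianGroup X` generated by the differences `Σ a − Σ b`. [folklore] -/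
def soloInformedPairSpan (E : Set (Multiset X × Multiset X)) : AddSubgroup (FreeAbelianGroup X) :=
  AddSubgroup.closure {z | ∃ p ∈ E, z = soloInformedMsum p.1 - soloInformedMsum p.2}

/-- **Honest chains of a calculus.** `SoloInformedMoveChain E x y`: the finite family `y` is obtained
from `x` by finitely many steps, each replacing, inside the current family, a sub-family `a` by `b`
or `b` by `a` for some rewrite pair `(a, b) ∈ E` — formally, the additive congruence relation on
`Multiset X` generated by `E` (Mathlib's inductive `AddConGen.Rel`). [folklore] -/
def SoloInformedMoveChain (E : Set (Multiset X × Multiset X)) (x y : Multiset X) : Prop :=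
  AddConGen.Rel (fun a b => (a, b) ∈ E) x y

variable {E : Set (Multiset X × Multiset X)}

/-- A rewrite pair is a one-step chain. [folklore] -/
theorem SoloInformedMoveChain.of_mem {a b : Multiset X} (h : (a, b) ∈ E) : SoloInformedMoveChain E a b :=
  AddConGen.Rel.of a b h

/-- Chains are reflexive. [folklore] -/
theorem SoloInformedMoveChain.refl (x : Multiset X) : SoloInformedMoveChain E x x :=
  AddConGen.Rel.refl x

/-- Chains are symmetric. [folklore] -/
theorem SoloInformedMoveChain.symm {x y : Multiset X} (h : SoloInformedMoveChain E x y) :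
    SoloInformedMoveChain E y x :=
  AddConGen.Rel.symm h

/-- Chains compose. [folklore] -/
theorem SoloInformedMoveChain.trans {x y z : Multiset X} (h₁ : SoloInformedMoveChain E x y)
    (h₂ : SoloInformedMoveChain E y z) : SoloInformedMoveChain E x z :=
  AddConGen.Rel.trans h₁ h₂

/-- Chains run in parallel inside a disjoint union of families. [folklore] -/
theorem SoloInformedMoveChain.add {w x y z : Multiset X} (h₁ : SoloInformedMoveChain E w x)
    (h₂ : SoloInformedMoveChain E y z) : SoloInformedMoveChain E (w + y) (x + z) :=
  AddConGen.Rel.add h₁ h₂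

/-- Chains run inside any larger family (right context). [folklore] -/
theorem SoloInformedMoveChain.add_right {x y : Multiset X} (h : SoloInformedMoveChain E x y)
    (t : Multiset X) : SoloInformedMoveChain E (x + t) (y + t) :=
  h.add (SoloInformedMoveChain.refl t)

/-- Chains run inside any larger family (left context). [folklore] -/
theorem SoloInformedMoveChain.add_left {x y : Multiset X} (t : Multiset X)
    (h : SoloInformedMoveChain E x y) : SoloInformedMoveChain E (t + x) (t + y) :=
  (SoloInformedMoveChain.refl t).add h

/-- Monotonicity of chains in the set of rewrite pairs. [folklore] -/
theorem SoloInformedMoveChain.mono {E' : Set (Multiset X × Multiset X)} (hEE' : E ⊆ E')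
    {x y : Multiset X} (h : SoloInformedMoveChain E x y) : SoloInformedMoveChain E' x y := by
  induction h with
  | of a b hab => exact SoloInformedMoveChain.of_mem (hEE' hab)
  | refl a => exact SoloInformedMoveChain.refl a
  | symm _ ih => exact ih.symm
  | trans _ _ ih₁ ih₂ => exact ih₁.trans ih₂
  | add _ _ ih₁ ih₂ => exact ih₁.add ih₂

/-! ### THEOREM CH-1 -/

/-- **Chains lie in the span**: if `x` and `y` are chain-connected then `Σ x − Σ y` lies in the
`ℤ`-span. [folklore] -/
theorem soloInformed_msum_sub_msum_mem_pairSpan_of_chain {x y : Multiset X}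
    (h : SoloInformedMoveChain E x y) :
    soloInformedMsum x - soloInformedMsum y ∈ soloInformedPairSpan E := by
  induction h with
  | of a b hab => exact AddSubgroup.subset_closure ⟨(a, b), hab, rfl⟩
  | refl a => rw [sub_self]; exact zero_mem _
  | symm _ ih => rw [← neg_sub]; exact neg_mem ih
  | trans _ _ ih₁ ih₂ =>
    have h := add_mem ih₁ ih₂
    rwa [sub_add_sub_cancel] at h
  | add _ _ ih₁ ih₂ =>
    have h := add_mem ih₁ ih₂
    rw [map_add, map_add]
    convert h using 1
    abel

/-- **Span elements are catalysed chains**: if `Σ x − Σ y` lies in the `ℤ`-span then, for some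
auxiliary family `t`, the families `x + t` and `y + t` are chain-connected.  Induction over the
span: for a generator `Σ a − Σ b = Σ x − Σ y` one has `x + b = y + a` as families, so `t = a`
works by one step; sums concatenate catalysts; negation is symmetry. [folklore] -/
theorem soloInformed_exists_chain_of_mem_pairSpan {z : FreeAbelianGroup X}
    (hz : z ∈ soloInformedPairSpan E) :
    ∀ x y : Multiset X, soloInformedMsum x - soloInformedMsum y = z →
      ∃ t : Multiset X, SoloInformedMoveChain E (x + t) (y + t) := by
  induction hz using AddSubgroup.closure_induction with
  | mem w hw =>
    obtain ⟨⟨a, b⟩, hab, rfl⟩ := hw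
    intro x y hxy
    dsimp only at hxy
    have hm : soloInformedMsum (x + b) = soloInformedMsum (y + a) := by
      rw [map_add, map_add, add_comm (soloInformedMsum y)]
      exact sub_eq_sub_iff_add_eq_add.mp hxy
    have he : x + b = y + a := soloInformedMsum_injective hm
    refine ⟨a, ?_⟩
    have h1 : SoloInformedMoveChain E (x + a) (x + b) :=
      SoloInformedMoveChain.add_left x (SoloInformedMoveChain.of_mem hab)
    rwa [he] at h1
  | zero =>
    intro x y hxy
    have he : x = y := soloInformedMsum_injective (sub_eq_zero.mp hxy)
    subst he
    exact ⟨0, SoloInformedMoveChain.refl _⟩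
  | add z₁ z₂ _ _ ih₁ ih₂ =>
    intro x y hxy
    obtain ⟨a, b, hz₂⟩ := soloInformed_exists_eq_msum_sub_msum z₂
    have h1 : soloInformedMsum (x + b) - soloInformedMsum (y + a) = z₁ := by
      rw [map_add, map_add]
      have h2 : soloInformedMsum x - soloInformedMsum y - z₂ = z₁ := by rw [hxy]; abel
      rw [← h2, hz₂]
      abel
    obtain ⟨t₁, ht₁⟩ := ih₁ _ _ h1
    obtain ⟨t₂, ht₂⟩ := ih₂ a b hz₂.symm
    refine ⟨b + t₁ + (a + t₂), ?_⟩
    have e1 : x + (b + t₁ + (a + t₂)) = (x + b + t₁) + (a + t₂) := by abel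
    have e2 : y + (b + t₁ + (a + t₂)) = (y + a + t₁) + (b + t₂) := by abel
    rw [e1, e2]
    exact (ht₁.add_right (a + t₂)).trans (SoloInformedMoveChain.add_left (y + a + t₁) ht₂)
  | neg z _ ih =>
    intro x y hxy
    obtain ⟨t, ht⟩ := ih y x (by rw [← neg_sub, hxy, neg_neg])
    exact ⟨t, ht.symm⟩

/-- **THEOREM CH-1 (`ℤ`-span = catalysed honest chains).** For any calculus `E` of rewrite pairs of
finite families, `Σ x − Σ y` lies in the `ℤ`-span of `E` if and only if `x + t` and `y + t` are
connected by an honest chain of `E`-rewrites for some auxiliary family `t`. [folklore] -/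
theorem soloInformed_msum_sub_msum_mem_pairSpan_iff (E : Set (Multiset X × Multiset X))
    (x y : Multiset X) :
    soloInformedMsum x - soloInformedMsum y ∈ soloInformedPairSpan E ↔
      ∃ t : Multiset X, SoloInformedMoveChain E (x + t) (y + t) := by
  constructor
  · exact fun h => soloInformed_exists_chain_of_mem_pairSpan h x y rfl
  · rintro ⟨t, ht⟩
    have h := soloInformed_msum_sub_msum_mem_pairSpan_of_chain ht
    rwa [map_add, map_add, add_sub_add_right_eq_sub] at h

/-- **THEOREM CH-1 for single generators.** `[x] − [y]` lies in the `ℤ`-span of `E` iff the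
one-element families `{x} + t` and `{y} + t` are chain-connected for some catalyst `t`.
[folklore] -/
theorem soloInformed_of_sub_of_mem_pairSpan_iff (E : Set (Multiset X × Multiset X)) (x y : X) :
    FreeAbelianGroup.of x - FreeAbelianGroup.of y ∈ soloInformedPairSpan E ↔
      ∃ t : Multiset X, SoloInformedMoveChain E ({x} + t) ({y} + t) := by
  rw [← soloInformedMsum_singleton, ← soloInformedMsum_singleton]
  exact soloInformed_msum_sub_msum_mem_pairSpan_iff E {x} {y}

/-- **The span is the kernel of the family-to-class map**: `Σ x ∈ soloInformedPairSpan E` iff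
`x + t` is chain-connected to `t` alone for some catalyst `t` (the case `y = 0`). [folklore] -/
theorem soloInformed_msum_mem_pairSpan_iff (E : Set (Multiset X × Multiset X)) (x : Multiset X) :
    soloInformedMsum x ∈ soloInformedPairSpan E ↔
      ∃ t : Multiset X, SoloInformedMoveChain E (x + t) t := by
  have h := soloInformed_msum_sub_msum_mem_pairSpan_iff E x 0
  simp only [map_zero, sub_zero, zero_add] at h
  exact h

end Summit.KontsevichZagierPeriods.KontsevichZagierPeriods.Theorems
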